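import Summits.QuantumFields.BalabanUV.T4Continuum.Spine.NE1p.DressedSmallFieldRecordLabelsKillSlotLetters

/-!
# T⁴ programme, spine estimate NE1′ (node O3b/H2) — THE KILL CONVENTION AT THE (2.14) ACTIVITY SLOT OF RECORD: PART 1's two ENDs with
# the activities written LITERALLY as `(slotsOfRecord …).act` of MAP §O1 O-8, summed over the labels of record (PART 2 of 2)

Cell `pub-balaban`, sub-cell `t4`, BINDER-OWNERS row NE1′ (owner lineage t4-ne1p-p1); NE1′ formalisation crew, unit
b2b-balaban-t4-ne1p-formalise-leaf-05, generation 13; crew row S65 ∕ DAG N29zzzzzj of `t4/formal/NE1p/LEAVES.md`, PART 2 of 2 (INTENT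
`CLAIMS.log` l.24556; BOOKED typer R-T152 l.24603; X240).  ADDITIVE — imports PART 1
`Spine/NE1p/DressedSmallFieldRecordLabelsKillSlotLetters` ONLY (⇒ this lineage's W91 `DressedSmallFieldRecordLabelsKillConvention`, crew S30
`DressedSmallFieldOnCoresSlotLetters`, the substrate's `SubstrateSlotsOfRecord`); THEOREMS ONLY (0 `def`, 0 `def … : Prop`, 0 cite,
0 sorry); nothing of PART 1 ∕ W91 ∕ N1a ∕ S30 ∕ the substrate restated — used BY NAME.

WHAT.  PART 1 put W91 §3's two ENDs (N0y's bounds AT THE CARRIERS OF RECORD for the activity of record of a letter family, SUMMED OVER THE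
LABELS OF RECORD, no `hkill`) at the substrate's core letters of record `coreLettersOf A` for ANY factor letters `A`, with N1a's operator-letter
blocks DISCHARGED into the substrate's scalar per-factor conditions (S30 §1).  THIS PART reads the same two ENDs AT THE ACTIVITY SLOT OF
RECORD — S30 §3's reading for N1a's chain:
* **`attachedPart_locE_le_slotsOfRecord_act_recordLabels`** ∕ **`muPart_locE_le_slotsOfRecord_act_recordLabels`** — PART 1's
  `attachedPart_∕muPart_locE_le_of_coreLettersOf_recordLabels` ONCE BY NAME each at `Op := OpDatum (SpeciesRec D n T ι′ Ω 𝒴)`, `A := L.A`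
  for slot letters `L : SlotLetters …`, the activities written LITERALLY as `(slotsOfRecord D ι c a σ P 𝒵 dom Jc V mI L).act
  (domEmb D.toTwoRuns (k+1) Z) (InnerLabel.ofTorus hk ℓ) op h` (`slotsOfRecord_act`, `rfl`).  Binders = PART 1's VERBATIM at that
  specialisation; conclusions = PART 1's = W91's with the slot of record in place of `actOfLetters (coreLettersOf L.A)`.
The class centre `ctr` stays GENERAL: its identification with run B's operator datum of record `opOf (slotsOfRecord …).F (slotsOfRecord …).rawB
g U k` (where row NE5's END of record places its centre conditions) and with NE1′'s window classes is the substrate's ∕ the owner's READING —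
NOT asserted here.

HONEST FRAMING.  A `rfl` reading + two by-name applications ([folklore] kernel theorems only); (B1b) stays RELOCATED as W91 words it (the
FILTERED sum IS Bałaban's resummed (2.14) small-field expansion — NE5's ∕ the substrate's to supply), NOT discharged; the FILTER is W91's
`killConv` BY FIAT; (B3-form) `hAmp` DISPLAYED (READING, UNPRINTED for Bałaban's cores — G-ne9p2-5); which tables realise Bałaban's
`C^{(k)}(Z₀,σ)`, `Γ_k` ([Balaban1988RGII] (2.14) p. 15 — TYPE ∕ CONTEXT only) and WHETHER the datum of record meets the centre conditions is
the SUBSTRATE's displayed identification, NOT claimed; 0 binders instantiated on Bałaban's densities; no numeral of print asserted; no wall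
item; wall v1.8 (T4-DAG v48–v54 — words, not kind) does NOT move; R-t4r2-Q2 NOT met thereby; NE1′ ⇐ the named binders — NOT printed, NOT
proved; spine PROVED 0∕9; count 9 unchanged.  ABSOLUTE RULE honoured.  Rung (B)+1 on ONE finite four-torus — NOT infinite volume, NOT a mass
gap, NOT OS on ℝ⁴, NOT Clay.  HONEST DEPENDENCY: continuum YM on T⁴ ⇐ BetaPertH ∧ nine spine estimates (0/9 proved); BetaPertH ⇐ (D1) ∧
(D4) ∧ CAP+tail; G-an2-4 gates asym, D1 and NE2/3/4. -/

noncomputable section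

namespace Summit.QuantumFields.BalabanUV.T4Continuum.NE1p.DressedSmallFieldRecordLabelsKillSlotsOfRecord

open scoped BigOperators Matrix
open Metric Set MeasureTheory
open Literature.MathematicalPhysics.QuantumFieldTheory.Balaban1983to89 (GaugeGroup)
open Literature.MathematicalPhysics.QuantumFieldTheory.Balaban1983to89.B13Resummation (locE)
open Literature.MathematicalPhysics.QuantumFieldTheory.Balaban1983to89.B5Prop11Lower (nsq)
open Literature.MathematicalPhysics.QuantumFieldTheory.Balaban1983to89.TreeLengthTorus (TDom tsys torusTreeLen)
open Literature.MathematicalPhysics.QuantumFieldTheory.Balaban1983to89.TreeLengthTorusGeometry (tgeometry)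
open Literature.MathematicalPhysics.QuantumFieldTheory.Balaban1983to89.B12TreeDecay (K₀)
open Summit.QuantumFields.BalabanUV.T4Continuum.B13OpDatum (OpDatum)
open Summit.QuantumFields.BalabanUV.T4Continuum.B13HistMeasurable (MeasPotFrame B13HistM)
open Summit.QuantumFields.BalabanUV.T4Continuum.B13StepTermLabels (InnerLabel)
open Summit.QuantumFields.BalabanUV.T4Continuum.B13InnerData (Bnd)
open Summit.QuantumFields.BalabanUV.T4Continuum.B13DomainGeometryTR (domEmb)
open Summit.QuantumFields.BalabanUV.T4Continuum.SubstrateTwoRunsDriven (DrivenRuns)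
open Summit.QuantumFields.BalabanUV.T4Continuum.SubstrateActivities (coreOf)
open Summit.QuantumFields.BalabanUV.T4Continuum.SubstrateGaussianLetters (gaussC linForm)
open Summit.QuantumFields.BalabanUV.T4Continuum.SubstrateGaussianLettersBall (detBudget)
open Summit.QuantumFields.BalabanUV.T4Continuum.SubstrateSlotsOfRecord (coreLettersOf SpeciesRec SlotLetters slotsOfRecord
  slotsOfRecord_act)
open Summit.QuantumFields.BalabanUV.T4Continuum.SubstrateNestedToriOfRecord (InnerLabel.ofTorus torusLabels)
open Summit.QuantumFields.BalabanUV.T4Continuum.SubstrateBondsOfCubes (bondsOfFineCubes)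
open Summit.QuantumFields.BalabanUV.T4Continuum.TorusBlockRefinement (trefineDom)
open Summit.QuantumFields.BalabanUV.T4Continuum.NE1p.DressedSmallFieldRecordLabelsKillSlotLetters
  (attachedPart_locE_le_of_coreLettersOf_recordLabels muPart_locE_le_of_coreLettersOf_recordLabels)

variable {G : Type} [GaugeGroup G] (D : DrivenRuns G) {k : ℕ} (hk : k + 1 + D.m' ≤ D.F.m + D.K) (P : MeasPotFrame D.carriers)
variable {n : Type} [Fintype n] [DecidableEq n] (ι : G →* Matrix n n ℂ) (c : ℂ) (a : ℝ) (σ : ℕ → ℂ)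
variable {T ι' S Ω 𝒴 : Type} {IOp : Type*}
  (𝒵 : D.carriers.Dom → InnerLabel D.carriers.Dom (Bnd D.toTwoRuns) → Type) [∀ X j, Fintype (𝒵 X j)]
  (dom : ∀ X j, 𝒵 X j → D.carriers.Dom)
  (Jc : D.carriers.Dom → InnerLabel D.carriers.Dom (Bnd D.toTwoRuns) → Type) [∀ X j, Fintype (Jc X j)]
  (V : D.carriers.Dom → InnerLabel D.carriers.Dom (Bnd D.toTwoRuns) → Type) [∀ X j, NormedAddCommGroup (V X j)]
  [∀ X j, InnerProductSpace ℝ (V X j)] [∀ X j, MeasurableSpace (V X j)] [∀ X j, BorelSpace (V X j)] [∀ X j, FiniteDimensional ℝ (V X j)]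
  (mI : D.carriers.Dom → InnerLabel D.carriers.Dom (Bnd D.toTwoRuns) → Type) [∀ X j, Fintype (mI X j)] [∀ X j, DecidableEq (mI X j)]
  (L : SlotLetters D (o := n) (T := T) (ι' := ι') (S := S) (Ω := Ω) (𝒴 := 𝒴) P (IOp := IOp) 𝒵 dom Jc V mI)

open Classical in
/-- **THE ATTACHED PART OF THE DRESSED SMALL-FIELD OUTPUT OF THE ACTIVITY SLOT OF RECORD, SUMMED OVER THE LABELS OF RECORD** (kernel;
PART 1's `attachedPart_locE_le_of_coreLettersOf_recordLabels` ONCE BY NAME at `Op := OpDatum (SpeciesRec D n T ι′ Ω 𝒴)`, `A := L.A`, the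
activities written LITERALLY as `(slotsOfRecord D ι c a σ P 𝒵 dom Jc V mI L).act (domEmb D.toTwoRuns (k+1) Z) (InnerLabel.ofTorus hk ℓ) op h`
— `slotsOfRecord_act`, `rfl`).  Binders = PART 1's VERBATIM (the substrate's scalar per-factor conditions `hbase` ∕ `hrdm` ∕ `hβ₀` ∕ `hd₀` ∕
`hrd` ∕ `hctr` ∕ `hbud` ∕ `hmq` at the slot letters `L.A`; `hroom` ∕ `hR′`; `hO` ∕ `hH`; W91's located clauses; (B3-form) `hAmp` on the explicit
letters; `hϱ` ∕ `hϱA`); the class centre `ctr` GENERAL (its identification with run B's operator datum of record is the substrate's READING, NOT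
asserted); conclusion = W91's with the slot of record. [folklore] -/
theorem attachedPart_locE_le_slotsOfRecord_act_recordLabels {W : Set (ℕ → ℝ)}
    {ctr : ℕ → (ℕ → ℝ) → D.carriers.BgB → OpDatum (SpeciesRec D n T ι' Ω 𝒴) × B13HistM P} {ROp RHist R' : ℕ → ℝ}
    {β₀ ϑ d₀ γ : D.carriers.Dom → InnerLabel D.carriers.Dom (Bnd D.toTwoRuns) → ℝ}
    (hroom : ∀ k, ROp k < R' k) (hR' : ∀ k, 0 ≤ R' k)
    (hbase : ∀ X j ii jj, Measurable fun a' => (L.A X j).base a' ii jj)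
    (hrdm : ∀ X j ii jj (o' : OpDatum (SpeciesRec D n T ι' Ω 𝒴)), Measurable fun a' => (L.A X j).rd a' ii jj o')
    (hβ₀ : ∀ X j, 0 ≤ β₀ X j) (hd₀ : ∀ X j, 0 < d₀ X j)
    (hrd : ∀ X j a' ii jj, ‖(L.A X j).rd a' ii jj‖ ≤ ϑ X j)
    (hctr : ∀ k, ∀ g ∈ W, ∀ (U : D.carriers.BgB) (X : D.carriers.Dom) (j : InnerLabel D.carriers.Dom (Bnd D.toTwoRuns))
      (a' : (Jc X j ⊕ 𝒵 X j) → ℝ × ℝ),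
      (∀ ii jj, ‖linForm (L.A X j).base (L.A X j).rd (ctr k g U).1 a' ii jj‖ ≤ β₀ X j) ∧
      ((linForm (L.A X j).base (L.A X j).rd (ctr k g U).1 a').det).im = 0 ∧
        d₀ X j ≤ ((linForm (L.A X j).base (L.A X j).rd (ctr k g U).1 a').det).re ∧
      (∀ x : mI X j → ℂ, γ X j * nsq x ≤ (star x ⬝ᵥ (linForm (L.A X j).base (L.A X j).rd (ctr k g U).1 a' *ᵥ x)).re))
    (hbud : ∀ k X j, detBudget (Fintype.card (mI X j)) (β₀ X j) (ϑ X j) (R' k) < d₀ X j)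
    (hmq : ∀ k X j, Fintype.card (mI X j) * ϑ X j * R' k < γ X j)
    {g : ℕ → ℝ} (hg : g ∈ W) {U : D.carriers.BgB} {op : OpDatum (SpeciesRec D n T ι' Ω 𝒴)} {h₀ w : B13HistM P} {ϱ : ℝ}
    (hO : ‖op - (ctr (k + 1) g U).1‖ ≤ ROp (k + 1)) (hH : ‖h₀ - (ctr (k + 1) g U).2‖ + ϱ * ‖w‖ ≤ RHist (k + 1))
    {A₀ A₁ Rkp r₁ : ℝ} (X₀ : (tsys 4 (D.cubesPerDir (k + 1))).Dom) (hA₀ : 0 ≤ A₀) (hA₁ : 0 ≤ A₁) (hr₁ : 0 ≤ r₁)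
    (hrate : r₁ + 2 * (64 * Real.log 162) + 2 ≤ Rkp)
    (hsmall : (A₀ + ϱ * A₁) * Real.exp (5 * r₁ + 1) * K₀ 64 8 * 9 * 64 ≤ 1)
    {δ κ α₆ Rc s t : ℝ} (hα₆ : 0 ≤ α₆)
    (hκ : 64 * Real.log 162 + 1 ≤ δ * κ) (h229 : Real.exp 1 * K₀ 64 8 * 64 * α₆ ≤ 1)
    (hs0 : 0 ≤ s) (hs1 : s ≤ 1) (ht : 0 ≤ t)
    (hRR : Rkp ≤ Rc - 64 * (Real.exp (Rc * 5) * s * Real.exp ((4 * (D.F.L : ℝ) ^ (4 * D.m')) * t)))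
    (hAmp : ∀ Z : (tsys 4 (D.cubesPerDir (k + 1))).Dom, Z.1 ⊆ X₀.1 → ∀ ℓ ∈ (torusLabels hk Z).filter fun ℓ =>
        ℓ.Z₀ = trefineDom D.F.L (D.cubesPerDir (k + 1)) Z ∧
          ℓ.P ⊆ bondsOfFineCubes hk (ℓ.Z₀.1 \ ℓ.fam.biUnion fun Y : (tsys 4 (D.F.L * D.cubesPerDir (k + 1))).Dom => Y.1) ∧
          (ℓ.Z₀.1 \ ℓ.fam.biUnion fun Y : (tsys 4 (D.F.L * D.cubesPerDir (k + 1))).Dom => Y.1).card ≤ 2 * ℓ.P.card,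
      (coreOf P (OpDatum (SpeciesRec D n T ι' Ω 𝒴)) 𝒵 dom Jc V
            (coreLettersOf D P (OpDatum (SpeciesRec D n T ι' Ω 𝒴)) 𝒵 dom Jc V mI L.A)
            (domEmb D.toTwoRuns (k + 1) Z) (InnerLabel.ofTorus hk ℓ)).lam.real univ *
          ((coreOf P (OpDatum (SpeciesRec D n T ι' Ω 𝒴)) 𝒵 dom Jc V
              (coreLettersOf D P (OpDatum (SpeciesRec D n T ι' Ω 𝒴)) 𝒵 dom Jc V mI L.A)
              (domEmb D.toTwoRuns (k + 1) Z) (InnerLabel.ofTorus hk ℓ)).wB *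
              (gaussC (mI (domEmb D.toTwoRuns (k + 1) Z) (InnerLabel.ofTorus hk ℓ)) *
                Real.sqrt (max 1 ((Fintype.card (mI (domEmb D.toTwoRuns (k + 1) Z) (InnerLabel.ofTorus hk ℓ))).factorial *
                  β₀ (domEmb D.toTwoRuns (k + 1) Z) (InnerLabel.ofTorus hk ℓ) ^
                    Fintype.card (mI (domEmb D.toTwoRuns (k + 1) Z) (InnerLabel.ofTorus hk ℓ)) +
                  d₀ (domEmb D.toTwoRuns (k + 1) Z) (InnerLabel.ofTorus hk ℓ)))) * Real.exp 0) *
          (Real.pi / ((γ (domEmb D.toTwoRuns (k + 1) Z) (InnerLabel.ofTorus hk ℓ) -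
              Fintype.card (mI (domEmb D.toTwoRuns (k + 1) Z) (InnerLabel.ofTorus hk ℓ)) *
                ϑ (domEmb D.toTwoRuns (k + 1) Z) (InnerLabel.ofTorus hk ℓ) * R' (k + 1)) / 2 / 2)) ^
            (Module.finrank ℝ (V (domEmb D.toTwoRuns (k + 1) Z) (InnerLabel.ofTorus hk ℓ)) / 2 : ℝ) *
        Real.exp ((coreOf P (OpDatum (SpeciesRec D n T ι' Ω 𝒴)) 𝒵 dom Jc V
            (coreLettersOf D P (OpDatum (SpeciesRec D n T ι' Ω 𝒴)) 𝒵 dom Jc V mI L.A)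
            (domEmb D.toTwoRuns (k + 1) Z) (InnerLabel.ofTorus hk ℓ)).N₁ * (‖h₀‖ + ϱ * ‖w‖)) ≤
      (A₀ + ϱ * A₁) * ((∏ Y ∈ ℓ.fam, (α₆ * Real.exp (-(δ * κ * torusTreeLen Y.1)) *
        Real.exp (-(Rc * (torusTreeLen Y.1 + 5))))) * (s ^ 2 * t) ^ ℓ.P.card))
    (hϱ : 2 ≤ ϱ) (hϱA : A₀ ≤ ϱ * A₁) :
    ‖locE (tgeometry 4 (D.cubesPerDir (k + 1))).ι (tgeometry 4 (D.cubesPerDir (k + 1))).cubes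
          (fun Z => ∑ ℓ ∈ (torusLabels hk Z).filter fun ℓ =>
              ℓ.Z₀ = trefineDom D.F.L (D.cubesPerDir (k + 1)) Z ∧
                ℓ.P ⊆ bondsOfFineCubes hk (ℓ.Z₀.1 \ ℓ.fam.biUnion fun Y : (tsys 4 (D.F.L * D.cubesPerDir (k + 1))).Dom => Y.1) ∧
                (ℓ.Z₀.1 \ ℓ.fam.biUnion fun Y : (tsys 4 (D.F.L * D.cubesPerDir (k + 1))).Dom => Y.1).card ≤ 2 * ℓ.P.card,
            (slotsOfRecord D ι c a σ P 𝒵 dom Jc V mI L).act (domEmb D.toTwoRuns (k + 1) Z) (InnerLabel.ofTorus hk ℓ) op (h₀ + w))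
            ((tgeometry 4 (D.cubesPerDir (k + 1))).cubes X₀) -
        locE (tgeometry 4 (D.cubesPerDir (k + 1))).ι (tgeometry 4 (D.cubesPerDir (k + 1))).cubes
          (fun Z => ∑ ℓ ∈ (torusLabels hk Z).filter fun ℓ =>
              ℓ.Z₀ = trefineDom D.F.L (D.cubesPerDir (k + 1)) Z ∧
                ℓ.P ⊆ bondsOfFineCubes hk (ℓ.Z₀.1 \ ℓ.fam.biUnion fun Y : (tsys 4 (D.F.L * D.cubesPerDir (k + 1))).Dom => Y.1) ∧
                (ℓ.Z₀.1 \ ℓ.fam.biUnion fun Y : (tsys 4 (D.F.L * D.cubesPerDir (k + 1))).Dom => Y.1).card ≤ 2 * ℓ.P.card,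
            (slotsOfRecord D ι c a σ P 𝒵 dom Jc V mI L).act (domEmb D.toTwoRuns (k + 1) Z) (InnerLabel.ofTorus hk ℓ) op h₀)
            ((tgeometry 4 (D.cubesPerDir (k + 1))).cubes X₀)‖ ≤
      4 * (Real.exp 1 * 9 * 64 * K₀ 64 8 ^ 2) * A₁ * Real.exp (-(r₁ * (tsys 4 (D.cubesPerDir (k + 1))).dj X₀)) := by
  rw [slotsOfRecord_act]
  exact attachedPart_locE_le_of_coreLettersOf_recordLabels D hk P (OpDatum (SpeciesRec D n T ι' Ω 𝒴)) 𝒵 dom Jc V mI L.A hroom hR'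
    hbase hrdm hβ₀ hd₀ hrd hctr hbud hmq hg hO hH X₀ hA₀ hA₁ hr₁ hrate hsmall hα₆ hκ h229 hs0 hs1 ht hRR hAmp hϱ hϱA

open Classical in
/-- **THE μ-PART OF THE DRESSED SMALL-FIELD OUTPUT OF THE ACTIVITY SLOT OF RECORD, SUMMED OVER THE LABELS OF RECORD** (kernel; PART 1's
`muPart_locE_le_of_coreLettersOf_recordLabels` ONCE BY NAME at `Op := OpDatum (SpeciesRec …)`, `A := L.A`, activities LITERALLY
`(slotsOfRecord …).act (domEmb D.toTwoRuns (k+1) Z) (InnerLabel.ofTorus hk ℓ) op h`; source pencil `h₀ + sμ • v`). [folklore] -/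
theorem muPart_locE_le_slotsOfRecord_act_recordLabels {W : Set (ℕ → ℝ)}
    {ctr : ℕ → (ℕ → ℝ) → D.carriers.BgB → OpDatum (SpeciesRec D n T ι' Ω 𝒴) × B13HistM P} {ROp RHist R' : ℕ → ℝ}
    {β₀ ϑ d₀ γ : D.carriers.Dom → InnerLabel D.carriers.Dom (Bnd D.toTwoRuns) → ℝ}
    (hroom : ∀ k, ROp k < R' k) (hR' : ∀ k, 0 ≤ R' k)
    (hbase : ∀ X j ii jj, Measurable fun a' => (L.A X j).base a' ii jj)
    (hrdm : ∀ X j ii jj (o' : OpDatum (SpeciesRec D n T ι' Ω 𝒴)), Measurable fun a' => (L.A X j).rd a' ii jj o')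
    (hβ₀ : ∀ X j, 0 ≤ β₀ X j) (hd₀ : ∀ X j, 0 < d₀ X j)
    (hrd : ∀ X j a' ii jj, ‖(L.A X j).rd a' ii jj‖ ≤ ϑ X j)
    (hctr : ∀ k, ∀ g ∈ W, ∀ (U : D.carriers.BgB) (X : D.carriers.Dom) (j : InnerLabel D.carriers.Dom (Bnd D.toTwoRuns))
      (a' : (Jc X j ⊕ 𝒵 X j) → ℝ × ℝ),
      (∀ ii jj, ‖linForm (L.A X j).base (L.A X j).rd (ctr k g U).1 a' ii jj‖ ≤ β₀ X j) ∧
      ((linForm (L.A X j).base (L.A X j).rd (ctr k g U).1 a').det).im = 0 ∧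
        d₀ X j ≤ ((linForm (L.A X j).base (L.A X j).rd (ctr k g U).1 a').det).re ∧
      (∀ x : mI X j → ℂ, γ X j * nsq x ≤ (star x ⬝ᵥ (linForm (L.A X j).base (L.A X j).rd (ctr k g U).1 a' *ᵥ x)).re))
    (hbud : ∀ k X j, detBudget (Fintype.card (mI X j)) (β₀ X j) (ϑ X j) (R' k) < d₀ X j)
    (hmq : ∀ k X j, Fintype.card (mI X j) * ϑ X j * R' k < γ X j)
    {g : ℕ → ℝ} (hg : g ∈ W) {U : D.carriers.BgB} {op : OpDatum (SpeciesRec D n T ι' Ω 𝒴)} {h₀ v : B13HistM P} {μ₁ : ℝ}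
    (hO : ‖op - (ctr (k + 1) g U).1‖ ≤ ROp (k + 1)) (hH : ‖h₀ - (ctr (k + 1) g U).2‖ + μ₁ * ‖v‖ ≤ RHist (k + 1))
    {A' Rkp r₁ μ₀ : ℝ} (X₀ : (tsys 4 (D.cubesPerDir (k + 1))).Dom) {sμ : ℂ} (hA : 0 ≤ A') (hr₁ : 0 ≤ r₁)
    (hrate : r₁ + 2 * (64 * Real.log 162) + 2 ≤ Rkp)
    (hsmall : A' * Real.exp (5 * r₁ + 1) * K₀ 64 8 * 9 * 64 ≤ 1)
    {δ κ α₆ Rc s t : ℝ} (hα₆ : 0 ≤ α₆)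
    (hκ : 64 * Real.log 162 + 1 ≤ δ * κ) (h229 : Real.exp 1 * K₀ 64 8 * 64 * α₆ ≤ 1)
    (hs0 : 0 ≤ s) (hs1 : s ≤ 1) (ht : 0 ≤ t)
    (hRR : Rkp ≤ Rc - 64 * (Real.exp (Rc * 5) * s * Real.exp ((4 * (D.F.L : ℝ) ^ (4 * D.m')) * t)))
    (hAmp : ∀ Z : (tsys 4 (D.cubesPerDir (k + 1))).Dom, Z.1 ⊆ X₀.1 → ∀ ℓ ∈ (torusLabels hk Z).filter fun ℓ =>
        ℓ.Z₀ = trefineDom D.F.L (D.cubesPerDir (k + 1)) Z ∧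
          ℓ.P ⊆ bondsOfFineCubes hk (ℓ.Z₀.1 \ ℓ.fam.biUnion fun Y : (tsys 4 (D.F.L * D.cubesPerDir (k + 1))).Dom => Y.1) ∧
          (ℓ.Z₀.1 \ ℓ.fam.biUnion fun Y : (tsys 4 (D.F.L * D.cubesPerDir (k + 1))).Dom => Y.1).card ≤ 2 * ℓ.P.card,
      (coreOf P (OpDatum (SpeciesRec D n T ι' Ω 𝒴)) 𝒵 dom Jc V
            (coreLettersOf D P (OpDatum (SpeciesRec D n T ι' Ω 𝒴)) 𝒵 dom Jc V mI L.A)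
            (domEmb D.toTwoRuns (k + 1) Z) (InnerLabel.ofTorus hk ℓ)).lam.real univ *
          ((coreOf P (OpDatum (SpeciesRec D n T ι' Ω 𝒴)) 𝒵 dom Jc V
              (coreLettersOf D P (OpDatum (SpeciesRec D n T ι' Ω 𝒴)) 𝒵 dom Jc V mI L.A)
              (domEmb D.toTwoRuns (k + 1) Z) (InnerLabel.ofTorus hk ℓ)).wB *
              (gaussC (mI (domEmb D.toTwoRuns (k + 1) Z) (InnerLabel.ofTorus hk ℓ)) *
                Real.sqrt (max 1 ((Fintype.card (mI (domEmb D.toTwoRuns (k + 1) Z) (InnerLabel.ofTorus hk ℓ))).factorial *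
                  β₀ (domEmb D.toTwoRuns (k + 1) Z) (InnerLabel.ofTorus hk ℓ) ^
                    Fintype.card (mI (domEmb D.toTwoRuns (k + 1) Z) (InnerLabel.ofTorus hk ℓ)) +
                  d₀ (domEmb D.toTwoRuns (k + 1) Z) (InnerLabel.ofTorus hk ℓ)))) * Real.exp 0) *
          (Real.pi / ((γ (domEmb D.toTwoRuns (k + 1) Z) (InnerLabel.ofTorus hk ℓ) -
              Fintype.card (mI (domEmb D.toTwoRuns (k + 1) Z) (InnerLabel.ofTorus hk ℓ)) *
                ϑ (domEmb D.toTwoRuns (k + 1) Z) (InnerLabel.ofTorus hk ℓ) * R' (k + 1)) / 2 / 2)) ^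
            (Module.finrank ℝ (V (domEmb D.toTwoRuns (k + 1) Z) (InnerLabel.ofTorus hk ℓ)) / 2 : ℝ) *
        Real.exp ((coreOf P (OpDatum (SpeciesRec D n T ι' Ω 𝒴)) 𝒵 dom Jc V
            (coreLettersOf D P (OpDatum (SpeciesRec D n T ι' Ω 𝒴)) 𝒵 dom Jc V mI L.A)
            (domEmb D.toTwoRuns (k + 1) Z) (InnerLabel.ofTorus hk ℓ)).N₁ * (‖h₀‖ + μ₁ * ‖v‖)) ≤
      A' * ((∏ Y ∈ ℓ.fam, (α₆ * Real.exp (-(δ * κ * torusTreeLen Y.1)) *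
        Real.exp (-(Rc * (torusTreeLen Y.1 + 5))))) * (s ^ 2 * t) ^ ℓ.P.card))
    (h0 : 0 < μ₀) (h01 : μ₀ < μ₁) (hμ : ‖sμ‖ ≤ μ₀) :
    ‖locE (tgeometry 4 (D.cubesPerDir (k + 1))).ι (tgeometry 4 (D.cubesPerDir (k + 1))).cubes
          (fun Z => ∑ ℓ ∈ (torusLabels hk Z).filter fun ℓ =>
              ℓ.Z₀ = trefineDom D.F.L (D.cubesPerDir (k + 1)) Z ∧
                ℓ.P ⊆ bondsOfFineCubes hk (ℓ.Z₀.1 \ ℓ.fam.biUnion fun Y : (tsys 4 (D.F.L * D.cubesPerDir (k + 1))).Dom => Y.1) ∧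
                (ℓ.Z₀.1 \ ℓ.fam.biUnion fun Y : (tsys 4 (D.F.L * D.cubesPerDir (k + 1))).Dom => Y.1).card ≤ 2 * ℓ.P.card,
            (slotsOfRecord D ι c a σ P 𝒵 dom Jc V mI L).act (domEmb D.toTwoRuns (k + 1) Z) (InnerLabel.ofTorus hk ℓ) op
              (h₀ + sμ • v))
            ((tgeometry 4 (D.cubesPerDir (k + 1))).cubes X₀) -
        locE (tgeometry 4 (D.cubesPerDir (k + 1))).ι (tgeometry 4 (D.cubesPerDir (k + 1))).cubes
          (fun Z => ∑ ℓ ∈ (torusLabels hk Z).filter fun ℓ =>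
              ℓ.Z₀ = trefineDom D.F.L (D.cubesPerDir (k + 1)) Z ∧
                ℓ.P ⊆ bondsOfFineCubes hk (ℓ.Z₀.1 \ ℓ.fam.biUnion fun Y : (tsys 4 (D.F.L * D.cubesPerDir (k + 1))).Dom => Y.1) ∧
                (ℓ.Z₀.1 \ ℓ.fam.biUnion fun Y : (tsys 4 (D.F.L * D.cubesPerDir (k + 1))).Dom => Y.1).card ≤ 2 * ℓ.P.card,
            (slotsOfRecord D ι c a σ P 𝒵 dom Jc V mI L).act (domEmb D.toTwoRuns (k + 1) Z) (InnerLabel.ofTorus hk ℓ) op h₀)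
            ((tgeometry 4 (D.cubesPerDir (k + 1))).cubes X₀)‖ ≤
      Real.exp 1 * 9 * 64 * K₀ 64 8 ^ 2 * A' * Real.exp (-(r₁ * (tsys 4 (D.cubesPerDir (k + 1))).dj X₀)) * (μ₀ / (μ₁ - μ₀)) := by
  rw [slotsOfRecord_act]
  exact muPart_locE_le_of_coreLettersOf_recordLabels D hk P (OpDatum (SpeciesRec D n T ι' Ω 𝒴)) 𝒵 dom Jc V mI L.A hroom hR'
    hbase hrdm hβ₀ hd₀ hrd hctr hbud hmq hg hO hH X₀ hA hr₁ hrate hsmall hα₆ hκ h229 hs0 hs1 ht hRR hAmp h0 h01 hμ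

end Summit.QuantumFields.BalabanUV.T4Continuum.NE1p.DressedSmallFieldRecordLabelsKillSlotsOfRecord

end
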